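import Summits.HubbardSuperconductivity.HubbardSuperconductivity.Theorems.AnisotropyChordTransferFibre3N1RowCellSoundT

/-!
# Route `AnisotropyChord` / H0 rotor rung, LEVEL 2 row `N₁` on the t-BLOCKS: the FIRST-ORDER (slope) cell certificate on a
base box, ★★★ `trialGap_of_partsT`

p2 g6's first-order row-`N₁` cell certificate (`…N1RowCheckS`: `endCheckB`/`finalCheckB` on a LITERAL staged box, `EndHolds`,
`cellCheckS_sound`; `…N1RowCellSoundS`: `PD`/`PartsOK`/`endsOfParts`/`ends_of_parts`, `trialGap_of_partsB`) is phrased through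
`c : L2.NamedCell` (`cellBox c a₁ a₂`).  The kernel side (`endCheckB`, `finalCheckB`, `PartsOK`) is already Box-level; this file
re-threads the SEMANTIC side through a base box `B₀` (sixteen slots; `cellBoxB B₀ 2 pi = some B` the literal staged box) so that
the same 22 part checks + final check certify a t-BLOCK cell `L2.TCell` (`…Fibre3L2TCell`, `…N1RowCellSoundT`):
* `EndHoldsOn B e D` — the end condition ON the staged box `B`; `endHoldsOn_of_checkB`; combinators `endHoldsOn_single/cons/
  add/sub/neg/append/chunks` (verbatim `endHolds_*`);
* ★★ `cellCheckSB_sound` — `cellCheckS_sound` for a base box (`PMem B₀ X`, `B₀.length = 16`);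
* ★★ `endsOn_of_parts` — the 22 part checks give the ten assembled end conditions on `B` (verbatim `ends_of_parts`);
* ★ `coreBoundB_of_partsB` — parts + final check ⟹ `CoreBoundB B₀ cmin`;
* ★★★ `trialGap_of_partsT`: for a block cell `c : L2.TCell` with `cellBoxB (c.box a₁ a₂) 2 pi = some B`, `PartsOK B pi d`,
  `finalCheckB B pi (endsOfParts pi.1 d) cmin = true`, `c.check = true`: for every `L` of the block (`c.L₀ ≤ L ≤ c.L₁`, `16 ≤ L`)
  and every ground profile with `(ν, a)` in the cell, `cmin · U ≤ N₁` (`trialGap_of_coreBoundT`).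
Prover seat `hubbard-h0-rotor-p2` g8; helper for piece A = stmt-HubbardSuperconductivity-23918 of rung 19089
(`--supports`, helper class).  Nothing here proves superconductivity in the Hubbard model; generic helper lemmas serving ONE
conditional reduction (the GM₃ ∀L certificate, Level-2 row `N₁`, t-blocks `48 ≤ L < 128`); the rotor TARGET as originally
worded stays FALSE (g15 verdict).  Mathlib + the tree only; no sorry.
-/

set_option linter.dupNamespace false
set_option autoImplicit false

namespace Summit.HubbardSuperconductivity.HubbardSuperconductivity.Theorems.AnisotropyChord.Transfer.Fibre3.L2.N1

open Summit.HubbardSuperconductivity.HubbardSuperconductivity.Theorems.AnisotropyChord.Transfer.Fibre3.L2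
open Literature.Analysis.ValidatedNumerics NonemptyInterval

/-! ## The end condition on a staged box -/

/-- ★ the SEMANTIC END CONDITION ON a staged box `B`: the datum `D` encloses the end term `e` at every pair `(x, cenPt B x)`,
`x ∈ B` (discharged by one `endCheckB`, or assembled from parts). -/
def EndHoldsOn (B : Box) (e : RExpr) (D : SD) : Prop :=
  ∀ x : ℕ → ℝ, B.mem x → D.Holds (x 2 - midI (B.toIvl 2)) (x 3 - midI (B.toIvl 3)) (e.eval x) (e.eval (cenPt B x))

/-- ★ a passing literal-box end check gives the end condition on that box. -/
theorem endHoldsOn_of_checkB {B : Box} {pi : ℕ × ℕ} {e : RExpr} {D : SD} (h : endCheckB B pi e D = true) :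
    EndHoldsOn B e D := by
  intro x hx
  unfold endCheckB at h
  split at h
  · exact absurd h (by simp)
  · rename_i A hA
    exact holds_of_SDincl h (sdEnclose_sound (holds_envC hx) e hA)

/-- a singleton sum is its term. -/
theorem endHoldsOn_single {B : Box} {e : RExpr} {D : SD} (h : EndHoldsOn B e D) : EndHoldsOn B (rsum [e]) D := h

/-- ★ PARTS: the end condition of `rsum (e :: e′ :: l)` from those of `e` and `rsum (e′ :: l)`. -/
theorem endHoldsOn_cons {B : Box} (prec : ℕ) {e e' : RExpr} {l : List RExpr} {D D' : SD} (h : EndHoldsOn B e D)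
    (h' : EndHoldsOn B (rsum (e' :: l)) D') : EndHoldsOn B (rsum (e :: e' :: l)) (D.add prec D') :=
  fun x hx => by
    have := SD.add_holds prec (h x hx) (h' x hx)
    simpa [rsum, RExpr.eval] using this

/-- end condition of a sum node. -/
theorem endHoldsOn_add {B : Box} (prec : ℕ) {e e' : RExpr} {D D' : SD} (h : EndHoldsOn B e D) (h' : EndHoldsOn B e' D') :
    EndHoldsOn B (.add e e') (D.add prec D') :=
  fun x hx => SD.add_holds prec (h x hx) (h' x hx)

/-- end condition of a difference node. -/
theorem endHoldsOn_sub {B : Box} (prec : ℕ) {e e' : RExpr} {D D' : SD} (h : EndHoldsOn B e D) (h' : EndHoldsOn B e' D') :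
    EndHoldsOn B (.sub e e') (D.sub prec D') :=
  fun x hx => SD.sub_holds prec (h x hx) (h' x hx)

/-- end condition of a negation node. -/
theorem endHoldsOn_neg {B : Box} {e : RExpr} {D : SD} (h : EndHoldsOn B e D) : EndHoldsOn B (.neg e) D.neg :=
  fun x hx => SD.neg_holds (h x hx)

/-- ★ APPEND: the end condition of `rsum (l₁ ++ l₂)` from those of `rsum l₁` and `rsum l₂`. -/
theorem endHoldsOn_append {B : Box} (prec : ℕ) (l₁ l₂ : List RExpr) {D D' : SD} (h : EndHoldsOn B (rsum l₁) D)
    (h' : EndHoldsOn B (rsum l₂) D') : EndHoldsOn B (rsum (l₁ ++ l₂)) (D.add prec D') :=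
  fun x hx => by
    rw [eval_rsum_append, eval_rsum_append]
    exact SD.add_holds prec (h x hx) (h' x hx)

/-- ★ CHUNKS: the end condition of `rsum (l.map f)` from those of the two chunks `l.take k`, `l.drop k`. -/
theorem endHoldsOn_chunks {B : Box} (prec : ℕ) {α : Type} (l : List α) (f : α → RExpr) (k : ℕ) {D D' : SD}
    (h : EndHoldsOn B (rsum ((l.take k).map f)) D) (h' : EndHoldsOn B (rsum ((l.drop k).map f)) D') :
    EndHoldsOn B (rsum (l.map f)) (D.add prec D') :=
  fun x hx => by
    have e1 : (rsum (l.map f)).eval x = (rsum ((l.take k).map f)).eval x + (rsum ((l.drop k).map f)).eval x := by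
      rw [← eval_rsum_append, ← List.map_append, List.take_append_drop]
    have e2 : (rsum (l.map f)).eval (cenPt B x) =
        (rsum ((l.take k).map f)).eval (cenPt B x) + (rsum ((l.drop k).map f)).eval (cenPt B x) := by
      rw [← eval_rsum_append, ← List.map_append, List.take_append_drop]
    rw [e1, e2]
    exact SD.add_holds prec (h x hx) (h' x hx)

/-! ## ★★ Soundness of the first-order check on a base box -/

/-- ★★ **SOUNDNESS OF THE FIRST-ORDER CELL CHECK ON A BASE BOX (interval layer)**: if `B` is the staged box of the base box
`B₀` (`cellBoxB B₀ M₂ pi = some B`, `B₀.length = 16`), every end condition holds on `B` and the final check passes on `B`, then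
for every real vector `X` prefix-in `B₀` whose staged coordinates satisfy the specs, and every list of five object values
bracketed by `objSpecsC` at `X`, the final vector `y = finalVec X vs` satisfies `1 ≤ y₆`, `1 ≤ U′(y)` and
`cmin·U′(y) ≤ N₁′(y)` — verbatim the argument of `cellCheckS_sound`. -/
theorem cellCheckSB_sound (B0 : Box) (hB0 : B0.length = 16) (M2 : ℕ) (cmin : ℚ) (pi : ℕ × ℕ) (ends : List (SD × SD))
    (B : Box) (hB : cellBoxB B0 M2 pi = some B)
    (hlen : ends.length = (objSpecsC M2).length)
    (hends : ∀ j (hj : j < (objSpecsC M2).length) (hj' : j < ends.length),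
      EndHoldsOn B ((objSpecsC M2)[j].1) (ends[j].1) ∧ EndHoldsOn B ((objSpecsC M2)[j].2) (ends[j].2))
    (hfin : finalCheckB B pi ends cmin = true) (hv : specsVarsOkC M2 = true) (X : ℕ → ℝ) (hX : PMem B0 X)
    (hsp : ∀ j (hj : j < (specs M2).length), ((specs M2)[j].1).eval X ≤ X (16 + j) ∧ X (16 + j) ≤ ((specs M2)[j].2).eval X)
    (vs : List ℝ) (hvl : vs.length = 5)
    (hob : ∀ j (hj : j < (objSpecsC M2).length) (hj' : j < vs.length),
      ((objSpecsC M2)[j].1).eval X ≤ vs[j] ∧ vs[j] ≤ ((objSpecsC M2)[j].2).eval X) :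
    1 ≤ finalVec X vs 6 ∧ 1 ≤ UpE.eval (finalVec X vs) ∧
      (cmin : ℝ) * UpE.eval (finalVec X vs) ≤ N1pE.eval (finalVec X vs) := by
  simp only [specsVarsOkC, Bool.and_eq_true] at hv
  obtain ⟨hv1, hv2⟩ := hv
  have hS : SpecsHold X B0.length (specs M2) := by
    rw [hB0]; exact specsHold_of X (specs M2) 16 hv1 hsp
  unfold cellBoxB at hB
  obtain ⟨hPB, hlenB⟩ := extendBox_sound pi.1 pi.2 X (specs M2) _ B hB hX hS
  have hO : ObjsHold X B.length (objSpecsC M2) vs := by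
    rw [hlenB, hB0]
    exact objsHold_of X _ (objSpecsC M2) vs (by rw [hvl]; simp [objSpecsC]) hv2 hob
  -- the stage-1 pair
  have hn17 : 17 ≤ B.length := by
    rw [hlenB, hB0]; simp only [specs, List.length_append, List.length_cons, List.length_nil, List.length_map]; omega
  obtain ⟨x₁, hx₁⟩ : ∃ x₁ : ℕ → ℝ, x₁ = trunc X B.length := ⟨_, rfl⟩
  have hmem : B.mem x₁ := by rw [hx₁]; exact mem_trunc hPB
  have hXeq : ∀ i, i < B.length → X i = x₁ i := fun i hi => by rw [hx₁]; unfold trunc; rw [if_pos hi]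
  have hcen : ∀ i, i ≠ 2 → i ≠ 3 → cenPt B x₁ i = x₁ i := fun i h2 h3 => by
    unfold cenPt; rw [Function.update_of_ne h3, Function.update_of_ne h2]
  -- object values vs their end terms at x₁ (truncation is invisible to the specs)
  have hvars : ∀ j (hj : j < (objSpecsC M2).length), varsBelow B.length ((objSpecsC M2)[j].1) = true ∧
      varsBelow B.length ((objSpecsC M2)[j].2) = true := by
    intro j hj
    rw [hlenB, hB0]
    have := List.all_eq_true.1 hv2 _ (List.getElem_mem hj)
    simpa [Bool.and_eq_true] using this
  have hob₁ : ∀ j (hj : j < (objSpecsC M2).length) (hj' : j < vs.length),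
      ((objSpecsC M2)[j].1).eval x₁ ≤ vs[j] ∧ vs[j] ≤ ((objSpecsC M2)[j].2).eval x₁ := by
    intro j hj hj'
    obtain ⟨hva, hvb⟩ := hvars j hj
    rw [hx₁, eval_trunc _ hva, eval_trunc _ hvb]
    exact hob j hj hj'
  have hends₁ : ∀ j (hj : j < (objSpecsC M2).length) (hj' : j < ends.length),
      (ends[j].1).Holds (x₁ 2 - midI (B.toIvl 2)) (x₁ 3 - midI (B.toIvl 3)) (((objSpecsC M2)[j].1).eval x₁)
        (((objSpecsC M2)[j].1).eval (cenPt B x₁)) ∧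
      (ends[j].2).Holds (x₁ 2 - midI (B.toIvl 2)) (x₁ 3 - midI (B.toIvl 3)) (((objSpecsC M2)[j].2).eval x₁)
        (((objSpecsC M2)[j].2).eval (cenPt B x₁)) := by
    intro j hj hj'
    obtain ⟨h1, h2⟩ := hends j hj hj'
    exact ⟨h1 x₁ hmem, h2 x₁ hmem⟩
  obtain ⟨ws, hws, hobjs⟩ := holds_objs (x := x₁) (z := cenPt B x₁) (objSpecsC M2) ends vs hlen
    (by rw [hvl]; simp [objSpecsC]) hends₁ hob₁
  -- the final-stage pair `(finalVec X vs, finalVec (cenPt B x₁) ws)`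
  have hXF : ∀ i, (envF (envC B) (ends.map fun p => p.1.hull p.2) i).Holds (x₁ 2 - midI (B.toIvl 2))
      (x₁ 3 - midI (B.toIvl 3)) (finalVec X vs i) (finalVec (cenPt B x₁) ws i) := by
    intro i
    unfold envF
    by_cases h4 : i < 4
    · rw [if_pos h4]
      have hyi : finalVec X vs i = x₁ i := by
        unfold finalVec
        interval_cases i <;> simp [hXeq 0 (by omega), hXeq 1 (by omega), hXeq 2 (by omega), hXeq 3 (by omega)]
      have hyzi : finalVec (cenPt B x₁) ws i = cenPt B x₁ i := by
        unfold finalVec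
        interval_cases i <;> simp
      rw [hyi, hyzi]; exact holds_envC hmem i
    · rw [if_neg h4]
      by_cases h5 : i = 4
      · subst h5
        rw [if_pos rfl]
        have hyi : finalVec X vs 4 = x₁ 16 := by unfold finalVec; simp [hXeq 16 (by omega)]
        have hyzi : finalVec (cenPt B x₁) ws 4 = x₁ 16 := by unfold finalVec; simp [hcen 16 (by decide) (by decide)]
        rw [hyi, hyzi]
        have h16 := holds_envC hmem 16
        rw [hcen 16 (by decide) (by decide)] at h16
        exact h16
      · rw [if_neg h5]
        have hyi : finalVec X vs i = vs.getD (i - 5) 0 := by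
          unfold finalVec
          simp [show i ≠ 0 by omega, show i ≠ 1 by omega, show i ≠ 2 by omega, show i ≠ 3 by omega, h5]
        have hyzi : finalVec (cenPt B x₁) ws i = ws.getD (i - 5) 0 := by
          unfold finalVec
          simp [show i ≠ 0 by omega, show i ≠ 1 by omega, show i ≠ 2 by omega, show i ≠ 3 by omega, h5]
        rw [hyi, hyzi]; exact hobjs (i - 5)
  have hD2 := incr_mem hmem 2
  have hD3 := incr_mem hmem 3
  unfold finalCheckB at hfin
  simp only at hfin
  split at hfin
  · rename_i M P U hM hP hU
    simp only [Bool.and_eq_true, decide_eq_true_eq] at hfin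
    obtain ⟨⟨hM0, hP0⟩, hU0⟩ := hfin
    have eM := (sdEnclose_bounds hXF hD2 hD3 _ hM).2
    have eP := (sdEnclose_bounds hXF hD2 hD3 _ hP).2
    have eU := (sdEnclose_bounds hXF hD2 hD3 _ hU).2
    have hM1 : (marginE cmin).eval (finalVec X vs) ≤ 0 := eM.trans (by exact_mod_cast hM0)
    have hP1 : (RExpr.neg fP).eval (finalVec X vs) ≤ ((-1 : ℚ) : ℝ) := eP.trans (by exact_mod_cast hP0)
    have hU1 : (RExpr.neg UpE).eval (finalVec X vs) ≤ ((-1 : ℚ) : ℝ) := eU.trans (by exact_mod_cast hU0)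
    simp only [RExpr.eval, fP, Rat.cast_neg, Rat.cast_one] at hP1 hU1
    simp only [marginE, RExpr.eval, cst] at hM1
    refine ⟨by linarith, by linarith, by linarith⟩
  · exact absurd hfin (by simp)

/-! ## ★★ The 22 part checks give the ten end conditions on the staged box -/

/-- ★★ the part checks on the literal staged box give the ten assembled end conditions ON it (verbatim `ends_of_parts`). -/
theorem endsOn_of_parts {pi : ℕ × ℕ} {B : Box} {d : PD} (h : PartsOK B pi d) :
    ∀ j (hj : j < (objSpecsC 2).length) (hj' : j < (endsOfParts pi.1 d).length),
      EndHoldsOn B ((objSpecsC 2)[j].1) ((endsOfParts pi.1 d)[j].1) ∧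
      EndHoldsOn B ((objSpecsC 2)[j].2) ((endsOfParts pi.1 d)[j].2) := by
  have E := fun {e : RExpr} {D : SD} (hh : endCheckB B pi e D = true) => endHoldsOn_of_checkB hh
  have hB1 : EndHoldsOn B (B2loC 2) (d.dBc.sub pi.1 d.dBt) := endHoldsOn_sub pi.1 (E h.hBc) (E h.hBt)
  have hB2 : EndHoldsOn B (B2hiC 2) (d.dBc.add pi.1 d.dBt) := endHoldsOn_add pi.1 (E h.hBc) (E h.hBt)
  have hA1 : EndHoldsOn B (A2lo 2) (d.dAc.sub pi.1 d.dAt) := endHoldsOn_sub pi.1 (E h.hAc) (E h.hAt)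
  have hA2 : EndHoldsOn B (A2hi 2) (d.dAc.add pi.1 d.dAt) := endHoldsOn_add pi.1 (E h.hAc) (E h.hAt)
  have hP1 : EndHoldsOn B (P2lo 2) (d.dPm.add pi.1 d.dPt.neg) :=
    endHoldsOn_append pi.1 _ [_] (E h.hPm) (endHoldsOn_neg (E h.hPt))
  have hP2 : EndHoldsOn B (P2hi 2) (d.dPm.add pi.1 d.dPt) := endHoldsOn_append pi.1 _ [_] (E h.hPm) (E h.hPt)
  have hQ1 : EndHoldsOn B (Q1lo 2) (d.dQz.add pi.1 (d.dQbl.add pi.1 (d.dQo.add pi.1 d.dQt.neg))) :=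
    endHoldsOn_cons pi.1 (E h.hQz) (endHoldsOn_cons pi.1 (E h.hQbl) (endHoldsOn_cons pi.1 (E h.hQo)
      (endHoldsOn_single (endHoldsOn_neg (E h.hQt)))))
  have hQ2 : EndHoldsOn B (Q1hi 2) (d.dQz.add pi.1 (d.dQbh.add pi.1 (d.dQo.add pi.1 d.dQt))) :=
    endHoldsOn_cons pi.1 (E h.hQz) (endHoldsOn_cons pi.1 (E h.hQbh) (endHoldsOn_cons pi.1 (E h.hQo)
      (endHoldsOn_single (E h.hQt))))
  have hJt : EndHoldsOn B (J1tail 2) (d.dJt1.add pi.1 d.dJt2) := endHoldsOn_append pi.1 _ _ (E h.hJt1) (E h.hJt2)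
  have hJbh : EndHoldsOn B (rsum ((blockP 2).map fun q => pairHi 3 q)) (d.dJbh1.add pi.1 d.dJbh2) :=
    endHoldsOn_chunks pi.1 (blockP 2) _ 14 (E h.hJbh1) (E h.hJbh2)
  have hJbl : EndHoldsOn B (rsum ((blockP 2).map fun q => pairLo 3 q)) (d.dJbl1.add pi.1 d.dJbl2) :=
    endHoldsOn_chunks pi.1 (blockP 2) _ 14 (E h.hJbl1) (E h.hJbl2)
  have hJ1 : EndHoldsOn B (J1lo 2)
      (d.dJp0l.add pi.1 (d.dJpMl.add pi.1 ((d.dJbl1.add pi.1 d.dJbl2).add pi.1 (d.dJo.add pi.1 (d.dJt1.add pi.1 d.dJt2).neg)))) :=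
    endHoldsOn_cons pi.1 (E h.hJp0l) (endHoldsOn_cons pi.1 (E h.hJpMl) (endHoldsOn_cons pi.1 hJbl (endHoldsOn_cons pi.1
      (E h.hJo) (endHoldsOn_single (endHoldsOn_neg hJt)))))
  have hJ2 : EndHoldsOn B (J1hi 2)
      (d.dJp0h.add pi.1 (d.dJpMh.add pi.1 ((d.dJbh1.add pi.1 d.dJbh2).add pi.1 (d.dJo.add pi.1 (d.dJt1.add pi.1 d.dJt2))))) :=
    endHoldsOn_cons pi.1 (E h.hJp0h) (endHoldsOn_cons pi.1 (E h.hJpMh) (endHoldsOn_cons pi.1 hJbh (endHoldsOn_cons pi.1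
      (E h.hJo) (endHoldsOn_single hJt))))
  intro j hj hj'
  have hj5 : j < 5 := by simpa [objSpecsC] using hj
  interval_cases j
  · exact ⟨by simpa [objSpecsC, endsOfParts] using hB1, by simpa [objSpecsC, endsOfParts] using hB2⟩
  · exact ⟨by simpa [objSpecsC, endsOfParts] using hP1, by simpa [objSpecsC, endsOfParts] using hP2⟩
  · exact ⟨by simpa [objSpecsC, endsOfParts] using hA1, by simpa [objSpecsC, endsOfParts] using hA2⟩
  · exact ⟨by simpa [objSpecsC, endsOfParts] using hQ1, by simpa [objSpecsC, endsOfParts] using hQ2⟩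
  · exact ⟨by simpa [objSpecsC, endsOfParts] using hJ1, by simpa [objSpecsC, endsOfParts] using hJ2⟩

/-- ★ the core bound of a base box from the 22 part checks and the final check on its literal staged box. -/
theorem coreBoundB_of_partsB {B0 : Box} (hB0 : B0.length = 16) {cmin : ℚ} {pi : ℕ × ℕ} {B : Box} {d : PD}
    (hbox : cellBoxB B0 2 pi = some B) (hparts : PartsOK B pi d) (hfin : finalCheckB B pi (endsOfParts pi.1 d) cmin = true) :
    CoreBoundB B0 cmin :=
  fun X hX hsp vs hvl hob => cellCheckSB_sound B0 hB0 2 cmin pi (endsOfParts pi.1 d) B hbox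
    (by simp [objSpecsC, endsOfParts]) (endsOn_of_parts hparts) hfin specsVarsOkC_two X hX hsp vs hvl hob

/-! ## ★★★ The first-order block cell certificate -/

variable (L : ℕ) [NeZero L]

/-- ★★★ **THE FIRST-ORDER t-BLOCK CELL CERTIFICATE**: the literal staged box IS the block cell's box, the 22 part checks pass
on it, and the final check passes with the assembled ends ⟹ for EVERY `L` of the block (`c.L₀ ≤ L`, `L ≤ c.L₁` unless
`c.L₁ = 0`, `16 ≤ L`) and EVERY ground two-magnon profile (`0 ≤ Δ < 1`) with `ν = λ₂/θ² ∈ [n₁/νd, n₂/νd]`,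
`a = Δf(x̂) ∈ [a₁, a₂]`:  `cmin · U ≤ N₁`. -/
theorem trialGap_of_partsT (c : L2.TCell) (a1 a2 cmin : ℚ) (pi : ℕ × ℕ) (B : Box) (d : PD)
    (hbox : cellBoxB (c.box a1 a2) 2 pi = some B) (hparts : PartsOK B pi d)
    (hfin : finalCheckB B pi (endsOfParts pi.1 d) cmin = true) (hc : c.check = true) (h16 : 16 ≤ L) (hL : c.L0 ≤ L)
    (hL1 : c.L1 = 0 ∨ L ≤ c.L1)
    {Δ lam2 : ℝ} {f : Tor L → ℝ} (hΔ0 : 0 ≤ Δ) (hΔ1 : Δ < 1) (hf : IsGroundTwoMagnon L Δ lam2 f)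
    (hν1 : (c.n1 : ℝ) / c.νd ≤ lam2 / (2 * Real.pi / L) ^ 2) (hν2 : lam2 / (2 * Real.pi / L) ^ 2 ≤ (c.n2 : ℝ) / c.νd)
    (ha1 : ((a1 : ℚ) : ℝ) ≤ Δ * f (K1 L)) (ha2 : Δ * f (K1 L) ≤ ((a2 : ℚ) : ℝ)) :
    (cmin : ℝ) * Uunit L Δ f ≤ trialGapN1 L Δ f :=
  trialGap_of_coreBoundT L c a1 a2 cmin (coreBoundB_of_partsB (c.box_length a1 a2) hbox hparts hfin) hc h16 hL hL1
    hΔ0 hΔ1 hf hν1 hν2 ha1 ha2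

end Summit.HubbardSuperconductivity.HubbardSuperconductivity.Theorems.AnisotropyChord.Transfer.Fibre3.L2.N1
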